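import Literature.Topology.FourManifolds.SeifertSurfaceExistence
import Literature.Topology.FourManifolds.BoundaryOrientation
import Literature.Topology.FourManifolds.SmoothOrientationSphereProofs
import Literature.Topology.FourManifolds.SpinDiffeomorphProofs
import Literature.Topology.FourManifolds.SliceGenusDiscMorse
import Mathlib.Analysis.SpecialFunctions.Sqrt
import HarnessLib

/-!
# The closed-up level surface `Λ` is orientable; Seifert's theorem from the leaves

Topic `Literature/Topology/FourManifolds`; fact seat
`provefact-Literature.Topology.FourManifolds.Knot.sliceGenus_eq_zero_iff`, glue step G6 and the
final assembly. Everything here is **proved**.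

`Λ = K ∪ θ⁻¹{±v}` (`SeifertLevelSurface.lean`) is exhibited as the boundary of a regular domain:
on the open neighbourhood `U = (unit tube) ∪ O₊ ∪ O₋` of `Λ` in `𝕊³` there is *one* smooth
function `H : U → ℝ` (`SeifertDatum.levelFn`) — `⟪w, Jv⟫ k(‖w‖²)` in the unit tube with
`k(r) = r^{-1/2}` for `r ≥ 1/4` and `k = 1` near `0`, and `⟪θ, Jv⟫` outside the tube of radius
`1/2`, the two agreeing on the overlap — with `H⁻¹(0) = Λ` and `dH ≠ 0` along `Λ`. The regular
sublevel set `W = {H ≤ 0}` is a manifold with boundary in the oriented `U ⊆ 𝕊³`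
(`isOrientable_sphere_holds`, `IsOrientable.opens`, `IsOrientable.of_isSmoothEmbedding`), its
boundary `∂W = {H = 0} = Λ` is orientable (the tree's `isOrientable_boundary`, Hirsch §4.4 /
Lee Prop. 15.24), and the identity `Λ ≅ ∂W` is a diffeomorphism between the slice-chart structure
of `Λ` and the boundary structure of `∂W` (smooth maps into either are the smooth maps into the
ambient). Hence `Λ` is orientable (`SeifertDatum.isOrientable_sheet`), and with
`SeifertSurfaceExistence.lean`: **every knot bounds a Seifert surface**, granted the circle-map
fact, Sard's theorem and the genus parity fact (`Knot.exists_hasSeifertSurfaceOfGenus_of_facts`);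
together with `SliceGenusDiscMorse.lean` the target fact `Knot.sliceGenus_eq_zero_iff` follows
from these three leaves and the three Morse-theoretic leaves
(`Knot.sliceGenus_eq_zero_iff_of_glue`).

## References

* A. Juhász, *Differential and Low-Dimensional Topology* (2023), proof of Prop. 4.10 ("oriented").
  [Juhasz2023]
* M. W. Hirsch, *Differential Topology* (1976), §4.4 (orientation of boundaries and of two-sided
  hypersurfaces). [HirschDT1976]
* J. M. Lee, *Introduction to Smooth Manifolds*, 2nd ed. (2013), Prop. 15.24, Prop. 5.47.
  [LeeSmoothManifolds2013]
-/

open scoped Manifold ContDiff Topology RealInnerProductSpace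
open Function Set Filter

noncomputable section

namespace Literature.Topology.FourManifolds

/-- Local notation: `𝔼 n` is the model Euclidean space `EuclideanSpace ℝ (Fin n)`. -/
local notation "𝔼 " n:arg => EuclideanSpace ℝ (Fin n)

/-- Local notation: `ℍ n` is the model half-space `EuclideanHalfSpace n`. -/
local notation "ℍ " n:arg => EuclideanHalfSpace n

/-- Local notation: `𝕊 n` is the unit sphere in `EuclideanSpace ℝ (Fin (n + 1))`. -/
local notation "𝕊 " n:arg => (Metric.sphere (0 : EuclideanSpace ℝ (Fin (n + 1))) 1)

/-! ### The blend `k` of `1` and `r^{-1/2}` -/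

/-- **The blend** `k(r) = 1` for `r ≤ 1/16`, `k(r) = 1/√r` for `r ≥ 1/4`, positive and smooth.
[folklore] -/
def invSqrtBlend (r : ℝ) : ℝ :=
  (1 - smoothStep (1 / 16) (1 / 4) r) + smoothStep (1 / 16) (1 / 4) r * (Real.sqrt r)⁻¹

/-- `k = 1` on `r ≤ 1/16`. [folklore] -/
theorem invSqrtBlend_of_le {r : ℝ} (h : r ≤ 1 / 16) : invSqrtBlend r = 1 := by
  rw [invSqrtBlend, smoothStep_of_le (by norm_num) h]; ring

/-- `k = 1/√r` on `r ≥ 1/4`. [folklore] -/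
theorem invSqrtBlend_of_ge {r : ℝ} (h : 1 / 4 ≤ r) : invSqrtBlend r = (Real.sqrt r)⁻¹ := by
  rw [invSqrtBlend, smoothStep_of_ge (by norm_num) h]; ring

/-- `k > 0`. [folklore] -/
theorem invSqrtBlend_pos (r : ℝ) : 0 < invSqrtBlend r := by
  by_cases h : r ≤ 1 / 16
  · rw [invSqrtBlend_of_le h]; exact one_pos
  · push Not at h
    have hs0 := (smoothStep_mem_Icc (1 / 16) (1 / 4) r).1
    have hs1 := (smoothStep_mem_Icc (1 / 16) (1 / 4) r).2
    have hr : 0 < (Real.sqrt r)⁻¹ := inv_pos.mpr (Real.sqrt_pos.mpr (by linarith))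
    rw [invSqrtBlend]
    rcases hs1.lt_or_eq with hlt | heq
    · nlinarith
    · rw [heq]; linarith

/-- `k` is smooth: near `r ≤ 1/16` it is `1`, elsewhere a smooth expression (`√` is smooth off
`0`). [folklore] -/
theorem contDiff_invSqrtBlend : ContDiff ℝ ∞ invSqrtBlend := by
  rw [contDiff_iff_contDiffAt]
  intro r
  by_cases h : r < 1 / 16
  · have hev : invSqrtBlend =ᶠ[𝓝 r] fun _ => 1 := by
      filter_upwards [Iio_mem_nhds h] with s hs
      exact invSqrtBlend_of_le (le_of_lt hs)
    exact contDiffAt_const.congr_of_eventuallyEq hev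
  · push Not at h
    have hr : r ≠ 0 := by intro h0; rw [h0] at h; norm_num at h
    exact (contDiff_const.sub (contDiff_smoothStep _ _)).contDiffAt.add
      ((contDiff_smoothStep _ _).contDiffAt.mul ((Real.contDiffAt_sqrt hr).inv
        (Real.sqrt_ne_zero'.mpr (by linarith))))

namespace SeifertDatum

open scoped Classical

variable {K : Knot} (D : SeifertDatum K)

/-! ### The modified tube function `G̃ = ⟪w, Jv⟫ k(‖w‖²)` -/

/-- **The modified tube function** `G̃ = cut(‖w‖²) ⟪w, Jv⟫ k(‖w‖²)` on the tube, `0` off it;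
on the unit tube `G̃ = ⟪w, Jv⟫ k(‖w‖²)`, which equals `⟪w, Jv⟫ / ‖w‖ = F` for `1/2 ≤ ‖w‖ ≤ 1`.
[folklore] -/
def tubeFn' (p : 𝕊 3) : ℝ :=
  if p ∈ range ⇑D.ν then stepDown 1 4 (‖D.fib p‖ ^ 2) *
    (⟪D.fib p, quarterRot (D.v : 𝔼 2)⟫ * invSqrtBlend (‖D.fib p‖ ^ 2)) else 0

/-- `G̃ (ν (x, w)) = cut(‖w‖²) ⟪w, Jv⟫ k(‖w‖²)`. [folklore] -/
theorem tubeFn'_apply (x : 𝕊 1) (w : 𝔼 2) :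
    D.tubeFn' (D.ν (x, w)) = stepDown 1 4 (‖w‖ ^ 2) *
      (⟪w, quarterRot (D.v : 𝔼 2)⟫ * invSqrtBlend (‖w‖ ^ 2)) := by
  rw [tubeFn', if_pos (mem_range_self _), fib_apply]

/-- On the closed unit tube `G̃ (ν (x, w)) = ⟪w, Jv⟫ k(‖w‖²)`. [folklore] -/
theorem tubeFn'_apply_of_norm_le_one (x : 𝕊 1) {w : 𝔼 2} (hw : ‖w‖ ≤ 1) :
    D.tubeFn' (D.ν (x, w)) = ⟪w, quarterRot (D.v : 𝔼 2)⟫ * invSqrtBlend (‖w‖ ^ 2) := by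
  rw [tubeFn'_apply, stepDown_of_le (by norm_num) (by nlinarith [norm_nonneg w]), one_mul]

/-- Off the closed tube of radius `2`, `G̃ = 0`. [folklore] -/
theorem tubeFn'_eq_zero_of_not_mem {p : 𝕊 3} (hp : p ∉ D.closedTubeSet 2) : D.tubeFn' p = 0 := by
  by_cases hr : p ∈ range ⇑D.ν
  · obtain ⟨⟨x, w⟩, rfl⟩ := hr
    rw [apply_mem_closedTubeSet_iff, not_le] at hp
    rw [tubeFn'_apply, stepDown_of_ge (by norm_num) (by nlinarith), zero_mul]
  · rw [tubeFn', if_neg hr]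

/-- **`G̃` is smooth on `𝕊³`.** [folklore] -/
theorem contMDiff_tubeFn' : ContMDiff (𝓡 3) 𝓘(ℝ, ℝ) ∞ D.tubeFn' := by
  intro p
  by_cases hp : p ∈ range ⇑D.ν
  · have hform : ContMDiffOn (𝓡 3) 𝓘(ℝ, ℝ) ∞
        (fun q => stepDown 1 4 (‖D.fib q‖ ^ 2) *
          (⟪D.fib q, quarterRot (D.v : 𝔼 2)⟫ * invSqrtBlend (‖D.fib q‖ ^ 2))) (range ⇑D.ν) := by
      have h1 : ContDiff ℝ ∞ fun w : 𝔼 2 => stepDown 1 4 (‖w‖ ^ 2) *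
          (⟪w, quarterRot (D.v : 𝔼 2)⟫ * invSqrtBlend (‖w‖ ^ 2)) :=
        ((contDiff_stepDown 1 4).comp (contDiff_norm_sq ℝ)).mul
          ((contDiff_id.inner ℝ contDiff_const).mul
            (contDiff_invSqrtBlend.comp (contDiff_norm_sq ℝ)))
      exact h1.contMDiff.comp_contMDiffOn D.contMDiffOn_fib
    have heq : EqOn D.tubeFn' (fun q => stepDown 1 4 (‖D.fib q‖ ^ 2) *
        (⟪D.fib q, quarterRot (D.v : 𝔼 2)⟫ * invSqrtBlend (‖D.fib q‖ ^ 2))) (range ⇑D.ν) :=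
      fun q hq => by rw [tubeFn', if_pos hq]
    exact (hform.congr heq).contMDiffAt (D.isOpen_range_ν.mem_nhds hp)
  · have hp2 : p ∉ D.closedTubeSet 2 := fun h => hp (D.closedTubeSet_subset_range 2 h)
    have hev : D.tubeFn' =ᶠ[𝓝 p] fun _ => 0 := by
      filter_upwards [(D.isClosed_closedTubeSet 2).isOpen_compl.mem_nhds hp2] with q hq
      exact D.tubeFn'_eq_zero_of_not_mem hq
    exact contMDiffAt_const.congr_of_eventuallyEq hev

/-- **On the unit tube, `Λ` is the zero set of `G̃`** (`k > 0`). [folklore] -/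
theorem tubeFn'_eq_zero_iff (x : 𝕊 1) {w : 𝔼 2} (hw : ‖w‖ ≤ 1) :
    D.tubeFn' (D.ν (x, w)) = 0 ↔ D.ν (x, w) ∈ D.sheet := by
  rw [D.tubeFn'_apply_of_norm_le_one x hw, D.apply_mem_sheet_iff x hw,
    mul_eq_zero, or_iff_left (invSqrtBlend_pos _).ne']

/-- **`G̃ = F` on the overlap** `1/2 < ‖w‖ ≤ 1`: there `k(‖w‖²) = 1/‖w‖`, `χ = 1` and
`θ = w/‖w‖`. [folklore] -/
theorem tubeFn'_eq_sheetFn (x : 𝕊 1) {w : 𝔼 2} (h1 : 1 / 2 < ‖w‖) (h2 : ‖w‖ ≤ 1) :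
    D.tubeFn' (D.ν (x, w)) = D.sheetFn (D.ν (x, w)) := by
  have hw0 : w ≠ 0 := by
    intro h; rw [h, norm_zero] at h1; norm_num at h1
  have hnm : D.ν (x, w) ∉ D.closedTubeSet (1 / 2) := by
    rw [apply_mem_closedTubeSet_iff, not_le]; exact h1
  rw [D.tubeFn'_apply_of_norm_le_one x h2, D.sheetFn_eq_of_not_mem hnm, D.θhat_tube x hw0 h2,
    invSqrtBlend_of_ge (by nlinarith), Real.sqrt_sq (norm_nonneg w), real_inner_smul_left]
  ring

/-- **`G̃` is regular along `Λ` in the open unit tube**: along the straight fibre line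
`s ↦ ν (x, w + s Jv)` through a point of `Λ` (`⟪w, Jv⟫ = 0`), `G̃` reads `s k(‖w + s Jv‖²)`
near `s = 0`, with derivative `k(‖w‖²) > 0` there. [folklore] -/
theorem not_isMCriticalPt_tubeFn' (x : 𝕊 1) {w : 𝔼 2} (hw : ‖w‖ < 1)
    (hΛ : ⟪w, quarterRot (D.v : 𝔼 2)⟫ = 0) :
    ¬ IsMCriticalPt (𝓡 3) D.tubeFn' (D.ν (x, w)) := by
  intro hcrit
  set c : 𝔼 2 := quarterRot (D.v : 𝔼 2) with hc
  have hcc : ⟪c, c⟫ = (1 : ℝ) := by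
    rw [hc, inner_quarterRot_quarterRot, real_inner_self_eq_norm_sq, D.norm_v]; norm_num
  -- the fibre line through the point
  set γ : ℝ → 𝕊 3 := fun s => D.ν (x, w + s • c) with hγ
  have hγs : ContMDiff 𝓘(ℝ, ℝ) (𝓡 3) ∞ γ :=
    D.ν.contMDiff.comp (contMDiff_const.prodMk
      ((contDiff_const.add (contDiff_id.smul contDiff_const)).contMDiff))
  have hγ0 : γ 0 = D.ν (x, w) := by simp [hγ]
  -- the model function
  set κ : ℝ → ℝ := fun s => invSqrtBlend (‖w + s • c‖ ^ 2) with hκ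
  have hκd : DifferentiableAt ℝ κ 0 :=
    ((contDiff_invSqrtBlend.comp ((contDiff_norm_sq ℝ).comp
      (contDiff_const.add (contDiff_id.smul contDiff_const)))).differentiable (by simp)).differentiableAt
  set φ : ℝ → ℝ := fun s => s * κ s with hφ
  have hφder : HasDerivAt φ (κ 0) 0 := by
    have h := (hasDerivAt_id (0 : ℝ)).mul hκd.hasDerivAt
    simp only [id_eq, one_mul, zero_mul, add_zero] at h
    exact h
  -- `G̃ ∘ γ = φ` near `0`
  have hnear : ∀ᶠ s in 𝓝 (0 : ℝ), ‖w + s • c‖ < 1 := by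
    have hcont : Continuous fun s : ℝ => ‖w + s • c‖ :=
      (continuous_const.add (continuous_id.smul continuous_const)).norm
    have h0 : ‖w + (0 : ℝ) • c‖ < 1 := by simpa using hw
    exact hcont.continuousAt.eventually_lt continuousAt_const h0
  have heq : (D.tubeFn' ∘ γ) =ᶠ[𝓝 0] φ := by
    filter_upwards [hnear] with s hs
    show D.tubeFn' (D.ν (x, w + s • c)) = s * κ s
    rw [D.tubeFn'_apply_of_norm_le_one x hs.le, inner_add_left, hΛ, real_inner_smul_left, hcc,
      zero_add, mul_one]
  -- chain rule and criticality: `d(G̃ ∘ γ)_0 = 0`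
  have hGd : MDifferentiableAt (𝓡 3) 𝓘(ℝ, ℝ) D.tubeFn' (γ 0) :=
    (D.contMDiff_tubeFn' _).mdifferentiableAt (by simp)
  have hγd : MDifferentiableAt 𝓘(ℝ, ℝ) (𝓡 3) γ 0 := (hγs 0).mdifferentiableAt (by simp)
  have hA : mfderiv 𝓘(ℝ, ℝ) 𝓘(ℝ, ℝ) (D.tubeFn' ∘ γ) 0 (1 : ℝ) = 0 := by
    rw [mfderiv_comp 0 hGd hγd]
    have : mfderiv (𝓡 3) 𝓘(ℝ, ℝ) D.tubeFn' (γ 0) = 0 := by rw [hγ0]; exact hcrit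
    rw [this]
    rfl
  have hB : (mfderiv 𝓘(ℝ, ℝ) 𝓘(ℝ, ℝ) φ 0 (1 : ℝ) : ℝ) = κ 0 := by
    rw [mfderiv_eq_fderiv]
    show deriv φ 0 = κ 0
    exact hφder.deriv
  have hAB := congrFun (congrArg DFunLike.coe
    (heq.mfderiv_eq (I := 𝓘(ℝ, ℝ)) (I' := 𝓘(ℝ, ℝ)))) (1 : ℝ)
  have hκ0 : κ 0 = 0 := hB.symm.trans (hAB.symm.trans hA)
  exact (invSqrtBlend_pos _).ne' hκ0

/-! ### The neighbourhood `U` of `Λ` and the level function `H` -/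

/-- **The open neighbourhood `U = (unit tube) ∪ O₊ ∪ O₋` of `Λ`.** [folklore] -/
def nbhd : TopologicalSpace.Opens (𝕊 3) :=
  ⟨D.tubeSet 1 ∪ (D.posSet ∪ D.negSet), (D.isOpen_tubeSet 1).union (D.isOpen_posSet.union
    D.isOpen_negSet)⟩

/-- Membership in `U`. [folklore] -/
theorem mem_nbhd_iff {q : 𝕊 3} : q ∈ D.nbhd ↔ q ∈ D.tubeSet 1 ∨ q ∈ D.posSet ∪ D.negSet :=
  Iff.rfl

/-- `Λ ⊆ U`. [folklore] -/
theorem mem_nbhd_of_mem_sheet {q : 𝕊 3} (hq : q ∈ D.sheet) : q ∈ D.nbhd := by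
  by_cases ht : q ∈ D.tubeSet 1
  · exact Or.inl ht
  · have hK : q ∉ range ⇑K := fun h => ht (D.range_K_subset_tubeSet one_pos h)
    have h12 : q ∉ D.closedTubeSet (1 / 2) := by
      intro h
      obtain ⟨⟨x, w⟩, ⟨-, hw⟩, rfl⟩ := h
      apply ht
      rw [apply_mem_tubeSet_iff]
      have : ‖w‖ ≤ 1 / 2 := by simpa using hw
      linarith
    rcases hq with h | h | h
    · exact absurd h hK
    · refine Or.inr (Or.inl ⟨h12, ?_⟩)
      show 0 < ⟪D.θhat q, (D.v : 𝔼 2)⟫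
      rw [h, real_inner_self_eq_norm_sq, D.norm_v]; norm_num
    · refine Or.inr (Or.inr ⟨h12, ?_⟩)
      show ⟪D.θhat q, (D.v : 𝔼 2)⟫ < 0
      rw [h, inner_neg_left, real_inner_self_eq_norm_sq, D.norm_v]; norm_num

/-- **The level function** `H : U → ℝ`: `G̃` on the unit tube, `F` on `O₊ ∪ O₋`. [folklore] -/
def levelFn (q : D.nbhd) : ℝ := if q.1 ∈ D.tubeSet 1 then D.tubeFn' q.1 else D.sheetFn q.1

/-- `H = G̃` on the unit tube. [folklore] -/
theorem levelFn_of_mem_tubeSet {q : D.nbhd} (h : q.1 ∈ D.tubeSet 1) :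
    D.levelFn q = D.tubeFn' q.1 := if_pos h

/-- **`H = F` on `O₊ ∪ O₋`** (on the overlap with the unit tube `G̃ = F`). [folklore] -/
theorem levelFn_of_mem_union {q : D.nbhd} (h : q.1 ∈ D.posSet ∪ D.negSet) :
    D.levelFn q = D.sheetFn q.1 := by
  by_cases ht : q.1 ∈ D.tubeSet 1
  · rw [D.levelFn_of_mem_tubeSet ht]
    obtain ⟨⟨x, w⟩, ⟨-, hw⟩, hxw⟩ := ht
    have hw1 : ‖w‖ < 1 := by simpa using hw
    have h12 : q.1 ∉ D.closedTubeSet (1 / 2) := by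
      rcases h with h | h
      · exact h.1
      · exact h.1
    rw [← hxw, apply_mem_closedTubeSet_iff, not_le] at h12
    rw [← hxw]
    exact D.tubeFn'_eq_sheetFn x h12 hw1.le
  · exact if_neg ht

/-- **`H` is smooth on `U`.** [folklore] -/
theorem contMDiff_levelFn : ContMDiff (𝓡 3) 𝓘(ℝ, ℝ) ∞ D.levelFn := by
  intro q
  have hval : ContMDiff (𝓡 3) (𝓡 3) ∞ (Subtype.val : D.nbhd → 𝕊 3) := contMDiff_subtype_val
  by_cases ht : q.1 ∈ D.tubeSet 1
  · refine ((D.contMDiff_tubeFn' q.1).comp q (hval q)).congr_of_eventuallyEq ?_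
    have hopen : IsOpen ((Subtype.val : D.nbhd → 𝕊 3) ⁻¹' D.tubeSet 1) :=
      (D.isOpen_tubeSet 1).preimage continuous_subtype_val
    filter_upwards [hopen.mem_nhds (show q.1 ∈ D.tubeSet 1 from ht)] with p hp
    exact D.levelFn_of_mem_tubeSet hp
  · have hq : q.1 ∈ D.posSet ∪ D.negSet := (D.mem_nbhd_iff.mp q.2).resolve_left ht
    refine ((D.contMDiff_sheetFn q.1).comp q (hval q)).congr_of_eventuallyEq ?_
    have hopen : IsOpen ((Subtype.val : D.nbhd → 𝕊 3) ⁻¹' (D.posSet ∪ D.negSet)) :=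
      (D.isOpen_posSet.union D.isOpen_negSet).preimage continuous_subtype_val
    filter_upwards [hopen.mem_nhds (show q.1 ∈ D.posSet ∪ D.negSet from hq)] with p hp
    exact D.levelFn_of_mem_union hp

/-- **`H⁻¹(0) = Λ`.** [folklore] -/
theorem levelFn_eq_zero_iff (q : D.nbhd) : D.levelFn q = 0 ↔ q.1 ∈ D.sheet := by
  by_cases ht : q.1 ∈ D.tubeSet 1
  · rw [D.levelFn_of_mem_tubeSet ht]
    obtain ⟨⟨x, w⟩, ⟨-, hw⟩, hxw⟩ := ht
    have hw1 : ‖w‖ < 1 := by simpa using hw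
    rw [← hxw]
    exact D.tubeFn'_eq_zero_iff x hw1.le
  · have hq : q.1 ∈ D.posSet ∪ D.negSet := (D.mem_nbhd_iff.mp q.2).resolve_left ht
    rw [D.levelFn_of_mem_union hq]
    rcases hq with h | h
    · exact (D.mem_sheet_iff_of_mem_posSet h).symm
    · exact (D.mem_sheet_iff_of_mem_negSet h).symm

/-- From `d(f ∘ val)_q = 0` on an open subset to `df_{q} = 0` (the inclusion of an open
submanifold has identity differential). [folklore] -/
theorem mfderiv_eq_zero_of_comp_val {f : (𝕊 3) → ℝ} (q : D.nbhd)
    (hf : MDifferentiableAt (𝓡 3) 𝓘(ℝ, ℝ) f q.1)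
    (h : mfderiv (𝓡 3) 𝓘(ℝ, ℝ) (f ∘ (Subtype.val : D.nbhd → 𝕊 3)) q = 0) :
    mfderiv (𝓡 3) 𝓘(ℝ, ℝ) f q.1 = 0 := by
  ext V
  have h1 := congrFun (congrArg DFunLike.coe
    (mfderiv_comp q hf (mdifferentiableAt_subtype_val q))) V
  have h2 : mfderiv (𝓡 3) (𝓡 3) (Subtype.val : D.nbhd → 𝕊 3) q V = V := by
    rw [mfderiv_subtype_val]; rfl
  have h3 : mfderiv (𝓡 3) 𝓘(ℝ, ℝ) (f ∘ (Subtype.val : D.nbhd → 𝕊 3)) q V = 0 := by rw [h]; rfl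
  have h4 : mfderiv (𝓡 3) 𝓘(ℝ, ℝ) f q.1 (mfderiv (𝓡 3) (𝓡 3) (Subtype.val : D.nbhd → 𝕊 3) q V)
      = 0 := h1.symm.trans h3
  rw [h2] at h4
  exact h4

/-- **`0` is a regular value of `H`**, attained exactly on `Λ`. [folklore] -/
theorem not_isMCriticalPt_levelFn (q : D.nbhd) (h0 : D.levelFn q = 0) :
    ¬ IsMCriticalPt (𝓡 3) D.levelFn q := by
  intro hcrit
  have hΛ : q.1 ∈ D.sheet := (D.levelFn_eq_zero_iff q).mp h0
  by_cases ht : q.1 ∈ D.tubeSet 1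
  · obtain ⟨⟨x, w⟩, ⟨-, hw⟩, hxw⟩ := ht
    have hw1 : ‖w‖ < 1 := by simpa using hw
    have hperp : ⟪w, quarterRot (D.v : 𝔼 2)⟫ = 0 := by
      rw [← D.apply_mem_sheet_iff x hw1.le, hxw]; exact hΛ
    have hev : D.levelFn =ᶠ[𝓝 q] (D.tubeFn' ∘ (Subtype.val : D.nbhd → 𝕊 3)) := by
      have hopen : IsOpen ((Subtype.val : D.nbhd → 𝕊 3) ⁻¹' D.tubeSet 1) :=
        (D.isOpen_tubeSet 1).preimage continuous_subtype_val
      filter_upwards [hopen.mem_nhds (show q.1 ∈ D.tubeSet 1 by rw [← hxw]; exact ⟨(x, w),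
        ⟨mem_univ _, hw⟩, rfl⟩)] with p hp
      exact D.levelFn_of_mem_tubeSet hp
    have hcomp : mfderiv (𝓡 3) 𝓘(ℝ, ℝ) (D.tubeFn' ∘ (Subtype.val : D.nbhd → 𝕊 3)) q = 0 :=
      hev.mfderiv_eq.symm.trans hcrit
    have hG := D.mfderiv_eq_zero_of_comp_val q ((D.contMDiff_tubeFn' _).mdifferentiableAt (by simp))
      hcomp
    rw [← hxw] at hG
    exact D.not_isMCriticalPt_tubeFn' x hw1 hperp hG
  · have hq : q.1 ∈ D.posSet ∪ D.negSet := (D.mem_nbhd_iff.mp q.2).resolve_left ht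
    have h12 : q.1 ∉ D.closedTubeSet (1 / 2) := by
      rcases hq with h | h
      · exact h.1
      · exact h.1
    have hK : q.1 ∉ range ⇑K := fun h => h12 (D.range_K_subset_closedTubeSet h)
    have hθ : D.θhat q.1 = (D.v : 𝔼 2) ∨ D.θhat q.1 = -(D.v : 𝔼 2) := by
      rcases hΛ with h | h | h
      · exact absurd h hK
      · exact Or.inl h
      · exact Or.inr h
    have hev : D.levelFn =ᶠ[𝓝 q] (D.sheetFn ∘ (Subtype.val : D.nbhd → 𝕊 3)) := by
      have hopen : IsOpen ((Subtype.val : D.nbhd → 𝕊 3) ⁻¹' (D.posSet ∪ D.negSet)) :=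
        (D.isOpen_posSet.union D.isOpen_negSet).preimage continuous_subtype_val
      filter_upwards [hopen.mem_nhds (show q.1 ∈ D.posSet ∪ D.negSet from hq)] with p hp
      exact D.levelFn_of_mem_union hp
    have hcomp : mfderiv (𝓡 3) 𝓘(ℝ, ℝ) (D.sheetFn ∘ (Subtype.val : D.nbhd → 𝕊 3)) q = 0 :=
      hev.mfderiv_eq.symm.trans hcrit
    have hF := D.mfderiv_eq_zero_of_comp_val q ((D.contMDiff_sheetFn _).mdifferentiableAt (by simp))
      hcomp
    exact D.not_isMCriticalPt_sheetFn hK h12 hθ hF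

end SeifertDatum

namespace SeifertDatum

open scoped Classical

variable {K : Knot} (D : SeifertDatum K)

/-! ### The regular domain `W = {H ≤ 0}` in `U` and its boundary `Λ` -/

/-- The charts of the open neighbourhood `U`, at the model `ℝ^(2+1)` (the form consumed by
`sublevelAtlas'`). [folklore] -/
instance instChartedSpaceNbhd' : ChartedSpace (𝔼 (2 + 1)) D.nbhd :=
  inferInstanceAs (ChartedSpace (𝔼 3) D.nbhd)

/-- The smooth structure of `U`, at the model `𝓡 (2 + 1)`. [folklore] -/
instance instIsManifoldNbhd' : IsManifold (𝓡 (2 + 1)) ∞ D.nbhd :=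
  inferInstanceAs (IsManifold (𝓡 3) ∞ D.nbhd)

/-- The subset `{H ≤ 0}` of `U`. [folklore] -/
def domainSet : Set D.nbhd := D.levelFn ⁻¹' Iic 0

/-- **The half-slice atlas of `W = {H ≤ 0}`**, a regular sublevel set in the manifold without
boundary `U` (`sublevelAtlas'`, Milnor 1963, Thm. 3.1). [cite: Milnor1963, Thm. 3.1] -/
def domainAtlas : HalfSliceAtlas (𝓡 (2 + 1)) D.domainSet :=
  sublevelAtlas' (k := 2) D.contMDiff_levelFn 0 fun q hq => D.not_isMCriticalPt_levelFn q hq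

/-- **The regular domain `W = {H ≤ 0}`** as a type (a `C^∞` `3`-manifold with boundary).
[cite: Milnor1963, Thm. 3.1] -/
def Domain (D : SeifertDatum K) : Type := ↥D.domainSet

namespace Domain

/-- The subspace topology of `W`. [folklore] -/
instance instTopologicalSpace : TopologicalSpace D.Domain :=
  inferInstanceAs (TopologicalSpace ↥D.domainSet)

/-- The charts of `W` (`HalfSliceAtlas.chartedSpace`). [cite: Milnor1963, Thm. 3.1] -/
instance instChartedSpace : ChartedSpace (ℍ (2 + 1)) D.Domain := D.domainAtlas.chartedSpace

/-- The smooth structure of `W`. [cite: Milnor1963, Thm. 3.1] -/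
instance instIsManifold : IsManifold (𝓡∂ (2 + 1)) ∞ D.Domain := D.domainAtlas.isManifold

end Domain

/-- The inclusion `W → U`. [folklore] -/
def domIncl : D.Domain → D.nbhd := Subtype.val

/-- **`W ↪ U` is a smooth embedding.** [cite: Milnor1963, Thm. 3.1] -/
theorem isSmoothEmbedding_domIncl :
    Manifold.IsSmoothEmbedding (𝓡∂ (2 + 1)) (𝓡 (2 + 1)) ∞ D.domIncl :=
  D.domainAtlas.isSmoothEmbedding_subtype_val'

/-- `W ↪ U` is smooth. [cite: Milnor1963, Thm. 3.1] -/
theorem contMDiff_domIncl : ContMDiff (𝓡∂ (2 + 1)) (𝓡 (2 + 1)) ∞ D.domIncl :=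
  D.domainAtlas.contMDiff_subtype_val'

/-- **Boundary points of `W` are the points of `Λ`.** [cite: Milnor1963, Thm. 3.1] -/
theorem isBoundaryPoint_domain_iff (p : D.Domain) :
    (𝓡∂ (2 + 1)).IsBoundaryPoint p ↔ (p.1 : 𝕊 3) ∈ D.sheet := by
  rw [← D.levelFn_eq_zero_iff]
  exact isBoundaryPoint_sublevel'_iff (k := 2) D.contMDiff_levelFn 0
    (fun q hq => D.not_isMCriticalPt_levelFn q hq) p

/-! ### Orientability of `W` and of its boundary -/

/-- **`U` is orientable** (an open subset of the orientable `𝕊³`). [folklore] -/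
theorem isOrientable_nbhd : IsOrientable (𝓡 (2 + 1)) D.nbhd :=
  (isOrientable_sphere_holds 3).opens D.nbhd

/-- **`W` is orientable** (codimension-`0` embedded in `U`). [cite: HirschDT1976, §4.4 p. 101] -/
theorem isOrientable_domain : IsOrientable (𝓡∂ (2 + 1)) D.Domain :=
  IsOrientable.of_isSmoothEmbedding D.isSmoothEmbedding_domIncl D.isOrientable_nbhd

/-- **`∂W` is orientable** (the tree's `isOrientable_boundary`, Hirsch §4.4 p. 103).
[cite: HirschDT1976, §4.4 p. 103] -/
theorem isOrientable_domain_boundary :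
    IsOrientable (𝓡 2) ((𝓡∂ (2 + 1)).boundary D.Domain) :=
  isOrientable_boundary 2 D.Domain D.isOrientable_domain

/-! ### The identity `Λ ≅ ∂W` is a diffeomorphism -/

/-- `Λ → U`, the inclusion. [folklore] -/
def sheetToNbhd (p : D.Sheet) : D.nbhd := ⟨p.1, D.mem_nbhd_of_mem_sheet p.2⟩

/-- `Λ → U` is smooth. [folklore] -/
theorem contMDiff_sheetToNbhd : ContMDiff (𝓡 2) (𝓡 (2 + 1)) ∞ D.sheetToNbhd := by
  rw [← ContMDiff.subtypeVal_comp_iff]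
  exact D.contMDiff_sheetIncl

/-- Points of `Λ` satisfy `H ≤ 0` (indeed `H = 0`). [folklore] -/
theorem sheetToNbhd_mem (p : D.Sheet) : D.sheetToNbhd p ∈ D.domainSet :=
  le_of_eq ((D.levelFn_eq_zero_iff _).mpr p.2)

/-- `Λ → W`. [folklore] -/
def sheetToDomain (p : D.Sheet) : D.Domain := ⟨D.sheetToNbhd p, D.sheetToNbhd_mem p⟩

/-- `Λ → W` is smooth (`HalfSliceAtlas.contMDiff_codRestrict`). [folklore] -/
theorem contMDiff_sheetToDomain : ContMDiff (𝓡 2) (𝓡∂ (2 + 1)) ∞ D.sheetToDomain :=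
  D.domainAtlas.contMDiff_codRestrict D.sheetToNbhd_mem D.contMDiff_sheetToNbhd

/-- Points of `Λ` are boundary points of `W`. [folklore] -/
theorem sheetToDomain_mem (p : D.Sheet) : D.sheetToDomain p ∈ (𝓡∂ (2 + 1)).boundary D.Domain :=
  (D.isBoundaryPoint_domain_iff _).mpr p.2

/-- **The identity `Λ → ∂W`.** [folklore] -/
def sheetToBoundary (p : D.Sheet) : ↥((𝓡∂ (2 + 1)).boundary D.Domain) :=
  ⟨D.sheetToDomain p, D.sheetToDomain_mem p⟩

/-- `Λ → ∂W` is smooth (`BoundaryManifold.contMDiff_codRestrict`). [folklore] -/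
theorem contMDiff_sheetToBoundary : ContMDiff (𝓡 2) (𝓡 2) ∞ D.sheetToBoundary :=
  BoundaryManifold.contMDiff_codRestrict D.sheetToDomain_mem D.contMDiff_sheetToDomain

/-- A boundary point of `W` lies on `Λ`. [folklore] -/
theorem boundary_val_mem (b : ↥((𝓡∂ (2 + 1)).boundary D.Domain)) :
    ((b.1).1 : 𝕊 3) ∈ D.sheet :=
  (D.isBoundaryPoint_domain_iff b.1).mp b.2

/-- **The identity `∂W → Λ`.** [folklore] -/
def boundaryToSheet (b : ↥((𝓡∂ (2 + 1)).boundary D.Domain)) : D.Sheet :=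
  D.toSheet (fun b : ↥((𝓡∂ (2 + 1)).boundary D.Domain) => ((b.1).1 : 𝕊 3))
    D.boundary_val_mem b

/-- `∂W → 𝕊³` is smooth. [folklore] -/
theorem contMDiff_boundary_val :
    ContMDiff (𝓡 2) (𝓡 3) ∞ fun b : ↥((𝓡∂ (2 + 1)).boundary D.Domain) => ((b.1).1 : 𝕊 3) :=
  (contMDiff_subtype_val.comp D.contMDiff_domIncl).comp
    (BoundaryManifold.isSmoothEmbedding_subtype_val (n := 2) (W := D.Domain)).1.contMDiff

/-- `∂W → Λ` is smooth (`contMDiff_toSheet`). [folklore] -/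
theorem contMDiff_boundaryToSheet : ContMDiff (𝓡 2) (𝓡 2) ∞ D.boundaryToSheet :=
  D.contMDiff_toSheet _ D.contMDiff_boundary_val

/-- **`Λ ≅ ∂W`**, a `C^∞` diffeomorphism (both are the same subset of `𝕊³`, and smooth maps into
either are the smooth maps into `𝕊³` with values in it). [folklore] -/
def sheetDiffeoBoundary : D.Sheet ≃ₘ^∞⟮𝓡 2, 𝓡 2⟯ ↥((𝓡∂ (2 + 1)).boundary D.Domain) where
  toFun := D.sheetToBoundary
  invFun := D.boundaryToSheet
  left_inv _ := rfl
  right_inv _ := rfl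
  contMDiff_toFun := D.contMDiff_sheetToBoundary
  contMDiff_invFun := D.contMDiff_boundaryToSheet

/-- **The closed-up level surface `Λ` is orientable** (Juhász 2023, proof of Prop. 4.10:
"oriented"; here: `Λ ≅ ∂W` for the orientable regular domain `W = {H ≤ 0}` of the oriented
`𝕊³`). [cite: Juhasz2023, proof of Prop. 4.10] -/
theorem isOrientable_sheet : IsOrientable (𝓡 2) D.Sheet :=
  IsOrientable.of_diffeomorph D.isOrientable_domain_boundary D.sheetDiffeoBoundary.symm (by simp)

end SeifertDatum

/-! ### Seifert's theorem and the target fact from the leaves -/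

/-- **Every knot bounds a Seifert surface** (`Knot.exists_hasSeifertSurfaceOfGenus`,
`SliceGenus.lean`; Seifert 1934 — here by the transversality proof of Juhász 2023, Prop. 4.10),
granted three leaves: the circle-map fact `Knot.exists_circleMap_eq_angle_of_hasFraming_zero`
(`SeifertCircleMap.lean`), Sard's theorem `sard` (`Analysis/Calculus/Sard.lean`) and the parity
of the first Betti number of a surface with one boundary circle
`even_finrank_singularHomology_one_of_boundary_circle` (`SurfaceGenusParity.lean`).
[cite: Juhasz2023, Prop. 4.10] -/
theorem Knot.exists_hasSeifertSurfaceOfGenus_of_facts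
    (hθ : Knot.exists_circleMap_eq_angle_of_hasFraming_zero)
    (hS : Literature.Analysis.Calculus.sard)
    (hpar : even_finrank_singularHomology_one_of_boundary_circle) :
    Knot.exists_hasSeifertSurfaceOfGenus :=
  Knot.exists_hasSeifertSurfaceOfGenus_of_isOrientable (fun _ D => D.isOrientable_sheet) hθ hS hpar

/-- **The target fact `Knot.sliceGenus_eq_zero_iff` from its leaves**: Seifert surfaces (the
three leaves above) and the smooth `4`-dimensional disc recognition
(`Knot.sliceGenus_eq_zero_iff_of_leaves`, `SliceGenusDiscMorse.lean`: cancellation of index-`0`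
critical points, one-local-minimum Morse functions, and the Morse equality for the Euler
characteristic). [cite: Fox1962, §4] -/
theorem Knot.sliceGenus_eq_zero_iff_of_glue
    (hθ : Knot.exists_circleMap_eq_angle_of_hasFraming_zero)
    (hS : Literature.Analysis.Calculus.sard)
    (hpar : even_finrank_singularHomology_one_of_boundary_circle)
    (h81 : Cobordism.Milnor1965_cancel_index_zero.{0})
    (hK : exists_isMorseAdapted_ncard_criticalSetOfIndex_zero_add_one_eq.{0} 1)
    (hχ : morseEuler_of_isMorseAdapted.{0}) :
    Knot.sliceGenus_eq_zero_iff :=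
  Knot.sliceGenus_eq_zero_iff_of_leaves (Knot.exists_hasSeifertSurfaceOfGenus_of_facts hθ hS hpar)
    h81 hK hχ

end Literature.Topology.FourManifolds
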